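import Literature.Probability.Percolation.CouplingLift
import Literature.Probability.Percolation.CouplingHSide
import Literature.Probability.Percolation.CoveringStrictMonotonicityAssembly
import HarnessLib

/-!
# The `𝒢`-side of the coupling: fresh coins on the cover and the lifted cluster
# (Martineau–Severo 2019, §5, Proposition 4.1)

Support file of the inline proof of `Literature.Probability.Percolation.MartineauSevero2019_cor22`.
Martineau–Severo (Ann. Probab. 47 (2019), §5) run the exploration of the enhanced cluster of `ℋ` with
coins of the cover `𝒢`: an edge query reads (all copies of) the designated lift of the edge, a bonus
reads fresh copies of the edges of the witness structure `Z(x, r)` and of one candidate lift towards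
each sphere vertex; "no vertex or edge will get explored more than once", "every element of `C'` is
connected to `o'` by an `η`-open path", and "`π` surjects `C'` onto `C`", whence Proposition 4.1.

Here, for the machine of `CouplingMachine.lean` on `ℋ = 𝒢/Γ` and the lift bookkeeping of
`CouplingLift.lean`, the coins are the star coins of `CoveringQuotientBlocks.lean` on the coordinates
`E(𝒢) ⊔ V(𝒢)` (`N` copies each; the copies of `Sum.inr x` serve as the private padding reservoir of the
bonus at the vertex lifted at `x`), and the percolation configuration of `𝒢` is the OR of the copies
(`StarCoins.orEdges`):

* `Coupling.locIdx` — the copy index a bonus at `u` uses for a candidate edge (a local injection on the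
  finitely many centres that can read that edge: the multigraph device);
* `Coupling.bonusCoins`, `Coupling.encG` — the `𝒢`-side encoding (bonus: the non-designated candidate
  edges, one private copy each, padded to exactly `N` coins by the reservoir), `Coupling.goodEnc_G` — it
  is good (FRESH: Conditions ①–④);
* `Coupling.liftedCluster` — along a run, every explored vertex's lift is joined to `x₀` by an open path
  of `orEdges` and every open designated lift is open (Condition ③);
* `Coupling.farEvent_of_reachState` — an explored vertex at distance `≥ L` puts `orEdges` in the far
  event `Far_L` of `CoveringStrictMonotonicityAssembly.lean`.

## References

* S. Martineau, F. Severo, Ann. Probab. 47 (2019), §5 (Structure of the process; Proposition 4.1)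
  [MartineauSevero2019].
-/

noncomputable section

namespace Literature.Probability.Percolation

open MeasureTheory Literature.Barriers.CriticalPhenomena ProbeHistory StarCoins
open scoped Classical

namespace Coupling

variable {V Γ : Type*} [Group Γ] [MulAction Γ V]
variable {G : SimpleGraph V} [(orbitQuotientGraph G Γ).LocallyFinite] {r : ℕ}
  (S : TwoLiftData Γ G r) (x₀ : V) (L N : ℕ)

local notation "Hq" => orbitQuotientGraph G Γ
local notation "Qt" => MulAction.orbitRel.Quotient Γ V
local notation "stOf" => stateOf (orbitQuotientGraph G Γ) (qmk Γ x₀) r L N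

/-! ### Copy indices: the local injections -/

variable (G Γ r) in
/-- The centres whose bonus may read the edge `e` of `𝒢`: vertices of `ℋ` within `3r+2` of the image of
an endpoint. [cite: MartineauSevero2019, §5 (Condition ④: "s-explored vertices u at distance at most r from some endpoint of e")] -/
def dom (e : Sym2 V) : Finset Qt :=
  ballFin Hq (qmk Γ (EnhProp42.ends e).1) (3 * r + 2) ∪ ballFin Hq (qmk Γ (EnhProp42.ends e).2) (3 * r + 2)

variable (G Γ r) in
/-- **The copy index** used by the bonus at `u` for the edge `e`: an injection of `dom e` into
`Fin N` (junk `0` off `dom e` or when `N` is too small). [cite: MartineauSevero2019, §5 (the M copies of an edge)] -/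
def locIdx [NeZero N] (e : Sym2 V) (u : Qt) : Fin N :=
  if h : u ∈ dom Γ G r e ∧ (dom Γ G r e).card ≤ N then Fin.castLE h.2 ((dom Γ G r e).equivFin ⟨u, h.1⟩) else 0

/-- The copy index is injective on `dom e`. [folklore] -/
theorem locIdx_injOn [NeZero N] {e : Sym2 V} (hN : (dom Γ G r e).card ≤ N) {u u' : Qt}
    (hu : u ∈ dom Γ G r e) (hu' : u' ∈ dom Γ G r e) (h : locIdx Γ G r N e u = locIdx Γ G r N e u') : u = u' := by
  unfold locIdx at h
  rw [dif_pos ⟨hu, hN⟩, dif_pos ⟨hu', hN⟩] at h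
  have h1 := Fin.castLE_injective hN h
  have h2 := (dom Γ G r e).equivFin.injective h1
  exact congrArg Subtype.val h2

/-- A centre reading a candidate edge lies in its `dom`. [folklore] -/
theorem mem_dom_of_mem_cand (hG : G.Connected) {x : V} {u : Qt} (hux : qmk Γ x = u) {f : Sym2 V}
    (hf : f ∈ cand S x u) : u ∈ dom Γ G r f := by
  have hH : (Hq).Connected := quot_connected hG
  have hz : (EnhProp42.ends f).1 ∈ f := EnhProp42.mem_iff_out.2 (Or.inl rfl)
  obtain ⟨-, h2⟩ := cand_endpoints (S := S) hG hux hf hz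
  rw [dom, Finset.mem_union, mem_ballFin]
  exact Or.inl (graphBall_mono _ _ (by omega) (mem_graphBall_symm h2))

/-! ### The bonus probe and the encoding -/

section Enc

variable [NeZero N]

/-- The candidate edges actually read at a bonus of `u`: the non-designated ones.
[cite: MartineauSevero2019, §5 (Step 2K+2: "For each p-unexplored edge e' in Z(x,r) …")] -/
def realEdges (σ : HState Qt) (lam : Qt → V) (u : Qt) : Finset (Sym2 V) :=
  (cand S (lam u) u).filter fun f => f ∉ desigSet G σ lam

/-- Their coins: one private copy each. [cite: MartineauSevero2019, §5 (Step 2K+2: "take its s-unexplored copy")] -/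
def realCoins (σ : HState Qt) (lam : Qt → V) (u : Qt) : Finset (Sym2 (CoinH V N)) :=
  (realEdges S σ lam u).image fun f => coin (Sum.inl f) (locIdx Γ G r N f u)

/-- The padding coins from the private reservoir of the lift of `u`. [cite: MartineauSevero2019, §5 (α_u := 1 with probability s/q: replaced by padding to a constant number of coins)] -/
def padCoins (σ : HState Qt) (lam : Qt → V) (u : Qt) : Finset (Sym2 (CoinH V N)) :=
  (Finset.univ.filter fun k : Fin N => k.val < N - (realEdges S σ lam u).card).image fun k => coin (Sum.inr (lam u)) k

/-- **The bonus probe**: exactly `N` fresh coins. [cite: MartineauSevero2019, §5 (Step 2K+2)] -/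
def bonusCoins (σ : HState Qt) (lam : Qt → V) (u : Qt) : Finset (Sym2 (CoinH V N)) :=
  realCoins S N σ lam u ∪ padCoins S N σ lam u

/-- **The `𝒢`-side encoding**: an edge query reads the `N` copies of its designated lift, a bonus reads
the bonus probe. [cite: MartineauSevero2019, §5 (Steps 2K+1, 2K+2 on 𝒢̂)] -/
def encG (b : List Bool) : Query Qt → Finset (Sym2 (CoinH V N))
  | Query.edge u v => coinsOf N (Sum.inl (desigE Γ G (lamOf S x₀ L N b) (u, v)))
  | Query.bonus u => bonusCoins S N (stOf b) (lamOf S x₀ L N b) u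

variable {S x₀ L N}

/-- Membership in `realCoins`. [folklore] -/
theorem mem_realCoins {σ : HState Qt} {lam : Qt → V} {u : Qt} {c : Sym2 (CoinH V N)} :
    c ∈ realCoins S N σ lam u ↔ ∃ f, f ∈ cand S (lam u) u ∧ f ∉ desigSet G σ lam ∧ c = coin (Sum.inl f) (locIdx Γ G r N f u) := by
  simp only [realCoins, realEdges, Finset.mem_image, Finset.mem_filter]
  constructor
  · rintro ⟨f, ⟨hf, hnd⟩, rfl⟩; exact ⟨f, hf, hnd, rfl⟩
  · rintro ⟨f, hf, hnd, rfl⟩; exact ⟨f, ⟨hf, hnd⟩, rfl⟩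

omit [NeZero N] in
/-- Membership in `padCoins`. [folklore] -/
theorem mem_padCoins {σ : HState Qt} {lam : Qt → V} {u : Qt} {c : Sym2 (CoinH V N)} :
    c ∈ padCoins S N σ lam u → ∃ k : Fin N, c = coin (Sum.inr (lam u)) k := by
  simp only [padCoins, Finset.mem_image, Finset.mem_filter, Finset.mem_univ, true_and]
  rintro ⟨k, -, rfl⟩; exact ⟨k, rfl⟩

/-- `|realCoins| = |realEdges|`. [folklore] -/
theorem card_realCoins (σ : HState Qt) (lam : Qt → V) (u : Qt) :
    (realCoins S N σ lam u).card = (realEdges S σ lam u).card := by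
  rw [realCoins, Finset.card_image_of_injOn]
  intro f _ f' _ h
  exact Sum.inl_injective (coin_eq_coin_iff.1 h).1

omit [NeZero N] in
/-- `|padCoins| = N - |realEdges|`. [folklore] -/
theorem card_padCoins (σ : HState Qt) (lam : Qt → V) (u : Qt) :
    (padCoins S N σ lam u).card = N - (realEdges S σ lam u).card := by
  set m := N - (realEdges S σ lam u).card with hm
  have hmN : m ≤ N := Nat.sub_le _ _
  rw [padCoins, Finset.card_image_of_injective _ (fun k k' h => (coin_eq_coin_iff.1 h).2)]
  have : (Finset.univ.filter fun k : Fin N => k.val < m) = (Finset.univ : Finset (Fin m)).image (Fin.castLE hmN) := by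
    ext k
    simp only [Finset.mem_filter, Finset.mem_univ, true_and, Finset.mem_image]
    constructor
    · intro hk; exact ⟨⟨k.val, hk⟩, Fin.ext rfl⟩
    · rintro ⟨j, rfl⟩; exact j.2
  rw [this, Finset.card_image_of_injective _ (Fin.castLE_injective hmN), Finset.card_univ, Fintype.card_fin]

/-- Real and padding coins are disjoint. [folklore] -/
theorem disjoint_realCoins_padCoins (σ : HState Qt) (lam : Qt → V) (u : Qt) :
    Disjoint (realCoins S N σ lam u) (padCoins S N σ lam u) := by
  rw [Finset.disjoint_left]
  intro c hc hc'
  obtain ⟨f, -, -, rfl⟩ := mem_realCoins.1 hc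
  obtain ⟨k, hk⟩ := mem_padCoins hc'
  exact Sum.inl_ne_inr (coin_eq_coin_iff.1 hk).1

/-- The number of candidate edges of a bonus at an explored-lifted `u`. [folklore] -/
theorem card_cand_le {x : V} {u : Qt} (hux : qmk Γ x = u) :
    (cand S x u).card ≤ 4 * r * (1 + ballVolume Hq u (r + 1)) + 2 * ballVolume Hq u (r + 1) := by
  rw [cand]
  refine (Finset.card_union_le _ _).trans (Nat.add_le_add (hux ▸ S.wt_card x) ?_)
  refine Finset.card_biUnion_le.trans ?_
  calc ∑ v ∈ sphereF Hq u (r + 1), (candPair S x v).card ≤ ∑ _v ∈ sphereF Hq u (r + 1), 2 :=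
        Finset.sum_le_sum fun v _ => Finset.card_le_two
    _ = (sphereF Hq u (r + 1)).card * 2 := by rw [Finset.sum_const, smul_eq_mul]
    _ ≤ (ballFin Hq u (r + 1)).card * 2 := Nat.mul_le_mul_right 2 (Finset.card_filter_le _ _)
    _ = 2 * ballVolume Hq u (r + 1) := by rw [EnhProp42.card_ballFin, mul_comm]

/-- **The bonus probe reads exactly `N` coins** (when `N` bounds the number of candidates). [folklore] -/
theorem card_bonusCoins {σ : HState Qt} {lam : Qt → V} {u : Qt} (hux : qmk Γ (lam u) = u)
    (hN : 4 * r * (1 + ballVolume Hq u (r + 1)) + 2 * ballVolume Hq u (r + 1) ≤ N) :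
    (bonusCoins S N σ lam u).card = N := by
  have hle : (realEdges S σ lam u).card ≤ N :=
    ((Finset.card_filter_le _ _).trans (card_cand_le (S := S) hux)).trans hN
  rw [bonusCoins, Finset.card_union_of_disjoint (disjoint_realCoins_padCoins σ lam u), card_realCoins,
    card_padCoins]
  omega

end Enc

/-! ### More invariants of the replay -/

/-- Attempted vertices are explored. [folklore] -/
theorem Y_subset_A (bs : List Bool) : (stOf bs).Y ⊆ (stOf bs).A := by
  induction bs with
  | nil => simp [stateOf, TExplore.stateOf, machine, HState.init]
  | cons a bs ih =>
    obtain ⟨mA, -, -, mY, -⟩ := mono_cons (H := Hq) (o := qmk Γ x₀) (r := r) (L := L) (N := N) a bs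
    cases hq : nq Hq (qmk Γ x₀) r L (stOf bs) with
    | none => rw [stateOf_cons_of_none hq]; exact ih
    | some q =>
      rw [stateOf_cons_of_some hq] at mA mY ⊢
      cases q with
      | edge u w =>
        intro y hy
        rw [Y_hstep_edge] at hy
        exact mA (ih hy)
      | bonus u =>
        obtain ⟨-, hu, -⟩ := nq_bonus_spec hq
        intro y hy
        rcases mem_Y_hstep_bonus.1 hy with rfl | hy
        · exact mA hu
        · exact mA (ih hy)

variable {S x₀ L N}

/-- **Candidates of attempted bonuses project into queried edges** (Condition ②, propagated along the
transcript). [cite: MartineauSevero2019, §5 (Condition ②)] -/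
theorem cand_proj_mem_Qd_of_mem_Y (hG : G.Connected) (hact : IsActionByAut G Γ) (bs : List Bool) :
    ∀ u ∈ (stOf bs).Y, ∀ f ∈ cand S (lamOf S x₀ L N bs u) u, ¬ (projE Γ f).IsDiag → projE Γ f ∈ (stOf bs).Qd := by
  induction bs with
  | nil => simp [stateOf, TExplore.stateOf, machine, HState.init]
  | cons a bs ih =>
    have hYA := Y_subset_A (x₀ := x₀) (L := L) (N := N) (Γ := Γ) (G := G) (r := r) bs
    obtain ⟨mA, mQd, -, mY, -⟩ := mono_cons (H := Hq) (o := qmk Γ x₀) (r := r) (L := L) (N := N) a bs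
    intro u hu f hf hfE
    -- old attempted vertices: lifts frozen, `Qd` grows
    have hold : u ∈ (stOf bs).Y → projE Γ f ∈ (stOf (a :: bs)).Qd := fun huY => by
      rw [lamOf_cons_of_mem_A a bs (hYA huY)] at hf
      exact mQd (ih u huY f hf hfE)
    cases hq : nq Hq (qmk Γ x₀) r L (stOf bs) with
    | none =>
      rw [stateOf_cons_of_none hq] at hu ⊢
      rw [stateOf_cons_of_none hq] at hold
      exact hold hu
    | some q =>
      cases q with
      | edge u' w =>
        rw [stateOf_cons_of_some hq, Y_hstep_edge] at hu
        exact hold hu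
      | bonus u' =>
        rw [stateOf_cons_of_some hq] at hu
        rcases mem_Y_hstep_bonus.1 hu with rfl | hu
        · obtain ⟨-, huA, -⟩ := nq_bonus_spec hq
          rw [lamOf_cons_of_mem_A a bs huA] at hf
          exact mQd (cand_proj_mem_Qd hG hact hq hf hfE)
        · exact hold hu

/-! ### The `𝒢`-side encoding is good -/

section Good

variable [NeZero N] (S x₀ L N)

/-- All coins that the bonus of `u` might read after the transcript `b`. [cite: MartineauSevero2019, §5 (Conditions ①–④)] -/
def potCoins (b : List Bool) (u : Qt) : Finset (Sym2 (CoinH V N)) :=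
  (cand S (lamOf S x₀ L N b u) u).image (fun f => coin (Sum.inl f) (locIdx Γ G r N f u)) ∪
    coinsOf N (Sum.inr (lamOf S x₀ L N b u))

/-- The coins used along a transcript: all copies of the designated lifts of the queried edges, and the
potential coins of the attempted bonuses. [cite: MartineauSevero2019, §5 (Conditions ①–④)] -/
def usedG (b : List Bool) : Finset (Sym2 (CoinH V N)) :=
  (stOf b).Qd.biUnion (fun e => coinsOf N (Sum.inl (desig S x₀ L N b e))) ∪ (stOf b).Y.biUnion (potCoins S x₀ L N b)

variable {S x₀ L N}

/-- Membership in `usedG`. [folklore] -/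
theorem mem_usedG {b : List Bool} {c : Sym2 (CoinH V N)} :
    c ∈ usedG S x₀ L N b ↔ (∃ e ∈ (stOf b).Qd, c ∈ coinsOf N (Sum.inl (desig S x₀ L N b e))) ∨
      ∃ u ∈ (stOf b).Y, c ∈ potCoins S x₀ L N b u := by
  simp [usedG]

/-- The bonus probe lies in the potential coins. [folklore] -/
theorem bonusCoins_subset_potCoins (b : List Bool) (u : Qt) :
    bonusCoins S N (stOf b) (lamOf S x₀ L N b) u ⊆ potCoins S x₀ L N b u := by
  intro c hc
  rw [potCoins, Finset.mem_union]
  rcases Finset.mem_union.1 hc with hc | hc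
  · obtain ⟨f, hf, -, rfl⟩ := mem_realCoins.1 hc
    exact Or.inl (Finset.mem_image.2 ⟨f, hf, rfl⟩)
  · obtain ⟨k, rfl⟩ := mem_padCoins hc
    exact Or.inr (mem_coinsOf.2 ⟨k, rfl⟩)

/-- **The `𝒢`-side encoding is good** (fresh; Martineau–Severo's Conditions ①–④): under the size
hypotheses on `N`, edge queries read `N` copies of a NEW designated lift (its edge was unqueried, so it
is neither an earlier designated lift — those project onto queried edges — nor a candidate of an
earlier bonus — those project onto queried edges too), and bonuses read `N` coins never read before
(non-designated candidates with the private copy index of `u`, injective on the centres that can read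
them; padding from the private reservoir of the lift of `u`).
[cite: MartineauSevero2019, §5 ("No vertex or edge will get explored more than once"; Conditions ①–④)] -/
theorem goodEnc_G (hG : G.Connected) (hact : IsActionByAut G Γ)
    (hN : ∀ u : Qt, 4 * r * (1 + ballVolume Hq u (r + 1)) + 2 * ballVolume Hq u (r + 1) ≤ N)
    (hNdom : ∀ e : Sym2 V, (dom Γ G r e).card ≤ N) :
    TExplore.GoodEnc (machine Hq (qmk Γ x₀) r L N) (encG S x₀ L N) (⊤ : SimpleGraph (CoinH V N)) := by
  have hH : (Hq).Connected := quot_connected hG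
  refine TExplore.goodEnc_of_used (usedG S x₀ L N) ?_ ?_ ?_ ?_
  · -- coins are edges of the coin graph
    intro b q _
    cases q with
    | edge u v => exact coinsOf_subset_edgeSet N _
    | bonus u =>
      intro c hc
      rcases Finset.mem_union.1 hc with hc | hc
      · obtain ⟨f, -, -, rfl⟩ := mem_realCoins.1 hc; exact coin_mem_edgeSet _ _
      · obtain ⟨k, rfl⟩ := mem_padCoins hc; exact coin_mem_edgeSet _ _
  · -- sizes
    intro b q hq
    have hq' : nq Hq (qmk Γ x₀) r L (stOf b) = some q := hq
    cases q with
    | edge u v => exact card_coinsOf N _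
    | bonus u =>
      obtain ⟨-, hu, -⟩ := nq_bonus_spec hq'
      exact card_bonusCoins (S := S) (qmk_lamOf hG hact hu) (hN u)
  · -- `enc b q ∪ used b ⊆ used (a :: b)`
    intro b q ans hq
    have hq' : nq Hq (qmk Γ x₀) r L (stOf b) = some q := hq
    obtain ⟨mA, mQd, mO, mY, msrc⟩ := mono_cons (H := Hq) (o := qmk Γ x₀) (r := r) (L := L) (N := N) ans b
    have hYA := Y_subset_A (x₀ := x₀) (L := L) (N := N) (Γ := Γ) (G := G) (r := r) b
    -- `used b ⊆ used (a :: b)`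
    have h2 : usedG S x₀ L N b ⊆ usedG S x₀ L N (ans :: b) := by
      intro c hc
      rw [mem_usedG]
      rcases mem_usedG.1 hc with ⟨e, he, hce⟩ | ⟨u, hu, hcu⟩
      · refine Or.inl ⟨e, mQd he, ?_⟩
        have := desig_append (S := S) hH [ans] b he
        rw [List.singleton_append] at this
        rw [this]; exact hce
      · refine Or.inr ⟨u, mY hu, ?_⟩
        rw [potCoins, lamOf_cons_of_mem_A ans b (hYA hu)]
        exact hcu
    have h1 : encG S x₀ L N b q ⊆ usedG S x₀ L N (ans :: b) := by
      intro c hc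
      rw [mem_usedG, stateOf_cons_of_some hq']
      cases q with
      | edge u v =>
        obtain ⟨hu, huv, -, -⟩ := nq_edge_spec hq'
        refine Or.inl ⟨s(u, v), mem_Qd_hstep_edge.2 (Or.inl rfl), ?_⟩
        have hdes : desig S x₀ L N (ans :: b) s(u, v) = desigE Γ G (lamOf S x₀ L N b) (u, v) := by
          unfold desig
          rw [stateOf_cons_of_some hq', src_hstep_edge_self]
          unfold desigE
          rw [lamOf_cons_of_mem_A ans b hu]
        rw [hdes]; exact hc
      | bonus u =>
        obtain ⟨-, hu, -⟩ := nq_bonus_spec hq'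
        refine Or.inr ⟨u, mem_Y_hstep_bonus.2 (Or.inl rfl), ?_⟩
        rw [potCoins, lamOf_cons_of_mem_A ans b hu, ← potCoins]
        exact bonusCoins_subset_potCoins b u hc
    convert Finset.union_subset h1 h2 using 3
  · -- disjointness from the used coins
    intro b q hq
    have hq' : nq Hq (qmk Γ x₀) r L (stOf b) = some q := hq
    have hYA := Y_subset_A (x₀ := x₀) (L := L) (N := N) (Γ := Γ) (G := G) (r := r) b
    rw [Finset.disjoint_left]
    intro c hc hcu
    cases q with
    | edge u v =>
      obtain ⟨hu, huv, -, hQ⟩ := nq_edge_spec hq'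
      have hux := qmk_lamOf (S := S) (x₀ := x₀) (L := L) (N := N) hG hact hu
      set ê := desigE Γ G (lamOf S x₀ L N b) (u, v) with hê
      have hproj : projE Γ ê = s(u, v) := projE_desigE hact hux huv
      obtain ⟨k, rfl⟩ := mem_coinsOf.1 hc
      rcases mem_usedG.1 hcu with ⟨e, he, hce⟩ | ⟨u', hu', hcu'⟩
      · obtain ⟨k', hk'⟩ := mem_coinsOf.1 hce
        have heq : ê = desig S x₀ L N b e := Sum.inl_injective (coin_eq_coin_iff.1 hk').1
        have := projE_desig (S := S) (x₀ := x₀) (L := L) (N := N) hG hact he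
        rw [← heq, hproj] at this
        exact hQ (this ▸ he)
      · rw [potCoins, Finset.mem_union] at hcu'
        rcases hcu' with hcu' | hcu'
        · obtain ⟨f, hf, hcf⟩ := Finset.mem_image.1 hcu'
          have heq : ê = f := Sum.inl_injective (coin_eq_coin_iff.1 hcf.symm).1
          have hnd : ¬ (projE Γ ê).IsDiag := by rw [hproj]; exact huv.ne
          have := cand_proj_mem_Qd_of_mem_Y (S := S) hG hact b u' hu' f hf (heq ▸ hnd)
          rw [← heq, hproj] at this
          exact hQ this
        · obtain ⟨k', hk'⟩ := mem_coinsOf.1 hcu'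
          exact Sum.inl_ne_inr (coin_eq_coin_iff.1 hk').1
    | bonus u =>
      obtain ⟨-, hu, -, hY, -⟩ := nq_bonus_spec hq'
      have hux := qmk_lamOf (S := S) (x₀ := x₀) (L := L) (N := N) hG hact hu
      rcases Finset.mem_union.1 hc with hc | hc
      · -- a real coin
        obtain ⟨f, hf, hnd, rfl⟩ := mem_realCoins.1 hc
        rcases mem_usedG.1 hcu with ⟨e, he, hce⟩ | ⟨u', hu', hcu'⟩
        · obtain ⟨k', hk'⟩ := mem_coinsOf.1 hce
          have heq : f = desig S x₀ L N b e := Sum.inl_injective (coin_eq_coin_iff.1 hk').1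
          exact hnd (mem_desigSet_iff.2 ⟨e, he, heq.symm⟩)
        · have hne : u' ≠ u := fun h => hY (h ▸ hu')
          rw [potCoins, Finset.mem_union] at hcu'
          rcases hcu' with hcu' | hcu'
          · obtain ⟨f', hf', hcf⟩ := Finset.mem_image.1 hcu'
            obtain ⟨h1, h2⟩ := coin_eq_coin_iff.1 hcf
            have hff : f' = f := Sum.inl_injective h1
            subst hff
            have hu'dom := mem_dom_of_mem_cand (S := S) hG (qmk_lamOf hG hact (hYA hu')) hf'
            have hudom := mem_dom_of_mem_cand (S := S) hG hux hf
            exact hne (locIdx_injOn (N := N) (hNdom f') hu'dom hudom h2)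
          · obtain ⟨k', hk'⟩ := mem_coinsOf.1 hcu'
            exact Sum.inl_ne_inr (coin_eq_coin_iff.1 hk').1
      · -- a padding coin
        obtain ⟨k, rfl⟩ := mem_padCoins hc
        rcases mem_usedG.1 hcu with ⟨e, he, hce⟩ | ⟨u', hu', hcu'⟩
        · obtain ⟨k', hk'⟩ := mem_coinsOf.1 hce
          exact Sum.inr_ne_inl (coin_eq_coin_iff.1 hk').1
        · have hne : u' ≠ u := fun h => hY (h ▸ hu')
          rw [potCoins, Finset.mem_union] at hcu'
          rcases hcu' with hcu' | hcu'
          · obtain ⟨f', -, hcf⟩ := Finset.mem_image.1 hcu'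
            exact Sum.inl_ne_inr (coin_eq_coin_iff.1 hcf).1
          · obtain ⟨k', hk'⟩ := mem_coinsOf.1 hcu'
            have h1 : lamOf S x₀ L N b u = lamOf S x₀ L N b u' := Sum.inr_injective (coin_eq_coin_iff.1 hk').1
            have := congrArg (qmk Γ) h1
            rw [hux, qmk_lamOf hG hact (hYA hu')] at this
            exact hne this.symm

end Good

/-! ### The lifted cluster -/

section Cluster

variable [NeZero N] (S x₀ L N)

/-- The transcript of the `𝒢`-side run after `k` steps on the coin configuration `ω`. [folklore] -/
abbrev btG (ω : Set (Sym2 (CoinH V N))) (k : ℕ) : List Bool :=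
  TExplore.bt (machine Hq (qmk Γ x₀) r L N) ((TExplore.texpl (machine Hq (qmk Γ x₀) r L N) (encG S x₀ L N)).hist k ω)

variable {S x₀ L N}

/-- One more step of the run, live query. [folklore] -/
theorem btG_succ_of_some {ω : Set (Sym2 (CoinH V N))} {k : ℕ} {q : Query Qt}
    (hE : TExplore.GoodEnc (machine Hq (qmk Γ x₀) r L N) (encG S x₀ L N) (⊤ : SimpleGraph (CoinH V N)))
    (hq : nq Hq (qmk Γ x₀) r L (stOf (btG S x₀ L N ω k)) = some q) :
    btG S x₀ L N ω (k + 1) =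
      TExplore.answer (machine Hq (qmk Γ x₀) r L N) q (encG S x₀ L N (btG S x₀ L N ω k) q,
        obs ω (encG S x₀ L N (btG S x₀ L N ω k) q)) :: btG S x₀ L N ω k :=
  TExplore.bt_hist_succ_of_some hE hq

/-- One more step of the run, halted. [folklore] -/
theorem btG_succ_of_none {ω : Set (Sym2 (CoinH V N))} {k : ℕ}
    (hE : TExplore.GoodEnc (machine Hq (qmk Γ x₀) r L N) (encG S x₀ L N) (⊤ : SimpleGraph (CoinH V N)))
    (hq : nq Hq (qmk Γ x₀) r L (stOf (btG S x₀ L N ω k)) = none) :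
    btG S x₀ L N ω (k + 1) = btG S x₀ L N ω k :=
  TExplore.bt_hist_succ_of_none hE hq

omit [NeZero N] in
/-- The recorded answer to an edge query (`𝒢`-side coins): some probed coin is open. [folklore] -/
theorem answerG_edge_iff {a c : Qt} {D : Finset (Sym2 (CoinH V N))} {ω : Set (Sym2 (CoinH V N))} :
    TExplore.answer (machine Hq (qmk Γ x₀) r L N) (Query.edge a c) (D, obs ω D) = true ↔
      (obs ω D).Nonempty := by
  simp [TExplore.answer, machine]

omit [NeZero N] in
/-- The recorded answer to a bonus query (`𝒢`-side coins): all probed coins open. [folklore] -/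
theorem answerG_bonus_iff {u : Qt} {D : Finset (Sym2 (CoinH V N))} {ω : Set (Sym2 (CoinH V N))} :
    TExplore.answer (machine Hq (qmk Γ x₀) r L N) (Query.bonus u) (D, obs ω D) = true ↔ obs ω D = D := by
  simp [TExplore.answer, machine]

/-- **The lifted cluster (Condition ③ and Proposition 4.1)**: along the run of the `𝒢`-side on the coin
configuration `ω`, with `η = orEdges ω` the OR of the copies: every explored vertex's lift is joined to
`x₀` by an `η`-open path, and the designated lift of every open queried edge is `η`-open.
[cite: MartineauSevero2019, §5 (Condition ③: "Every element of C' is connected to o' by an η-open path")] -/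
theorem liftedCluster (hG : G.Connected) (hact : IsActionByAut G Γ)
    (hN : ∀ u : Qt, 4 * r * (1 + ballVolume Hq u (r + 1)) + 2 * ballVolume Hq u (r + 1) ≤ N)
    (hNdom : ∀ e : Sym2 V, (dom Γ G r e).card ≤ N) (ω : Set (Sym2 (CoinH V N))) (k : ℕ) :
    (∀ v ∈ (stOf (btG S x₀ L N ω k)).A,
      (SimpleGraph.fromEdgeSet (orEdges N G ω)).Reachable x₀ (lamOf S x₀ L N (btG S x₀ L N ω k) v)) ∧
    (∀ e ∈ (stOf (btG S x₀ L N ω k)).O, desig S x₀ L N (btG S x₀ L N ω k) e ∈ orEdges N G ω) := by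
  have hH : (Hq).Connected := quot_connected hG
  have hE := goodEnc_G (S := S) (x₀ := x₀) (L := L) (N := N) hG hact hN hNdom
  induction k with
  | zero =>
    have h0 : btG S x₀ L N ω 0 = [] := rfl
    rw [h0]
    refine ⟨?_, ?_⟩
    · intro v hv
      simp only [stateOf, TExplore.stateOf, machine, HState.init, Finset.mem_singleton] at hv
      subst hv; rfl
    · intro e he
      simp [stateOf, TExplore.stateOf, machine, HState.init] at he
  | succ k ih =>
    obtain ⟨ihA, ihO⟩ := ih
    cases hq : nq Hq (qmk Γ x₀) r L (stOf (btG S x₀ L N ω k)) with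
    | none =>
      rw [btG_succ_of_none hE hq]
      exact ⟨ihA, ihO⟩
    | some q =>
      rw [btG_succ_of_some hE hq]
      generalize hb : btG S x₀ L N ω k = b at hq ihA ihO ⊢
      set ans := TExplore.answer (machine Hq (qmk Γ x₀) r L N) q (encG S x₀ L N b q, obs ω (encG S x₀ L N b q)) with hans
      -- old designated lifts and old lifts are unchanged
      have hdes : ∀ e ∈ (stOf b).Qd, desig S x₀ L N (ans :: b) e = desig S x₀ L N b e := fun e he => by
        have := desig_append (S := S) hH [ans] b he
        rwa [List.singleton_append] at this
      have hlam : ∀ v ∈ (stOf b).A, lamOf S x₀ L N (ans :: b) v = lamOf S x₀ L N b v := fun v hv =>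
        lamOf_cons_of_mem_A ans b hv
      have hinv := inv_stateOf (H := Hq) (o := qmk Γ x₀) (r := r) (L := L) (N := N) hH b
      rw [stateOf_cons_of_some hq]
      cases q with
      | edge u v =>
        obtain ⟨hu, huv, hd, hQ⟩ := nq_edge_spec hq
        have hux := qmk_lamOf (S := S) (x₀ := x₀) (L := L) (N := N) hG hact hu
        set ê := desigE Γ G (lamOf S x₀ L N b) (u, v) with hê
        have hêE : ê ∈ G.edgeSet := desigE_mem_edgeSet hact hux huv
        -- answer semantics: `true` iff some copy of `ê` is open iff `ê ∈ η`
        have hopen : ans = true → ê ∈ orEdges N G ω := fun h => by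
          rw [hans] at h
          have h1 : (obs ω (coinsOf N (Sum.inl ê))).Nonempty :=
            answerG_edge_iff.1 h
          exact mem_orEdges.2 ⟨hêE, obs_coinsOf_nonempty_iff.1 h1⟩
        refine ⟨?_, ?_⟩
        · intro w hw
          rcases mem_A_hstep_edge.1 hw with hw | ⟨ha, rfl⟩
          · rw [hlam w hw]; exact ihA w hw
          · by_cases hwA : w ∈ (stOf b).A
            · rw [hlam w hwA]; exact ihA w hwA
            · rw [lamOf_cons, hq]
              simp only [ha, hwA, not_false_eq_true, and_self, if_true, Function.update_self]
              have hreach := ihA u hu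
              have h' : (Hq).Adj (qmk Γ (lamOf S x₀ L N b u)) w := by rw [hux]; exact huv
              have hadj := (edgeLift_spec hact h').1
              refine hreach.trans (SimpleGraph.Adj.reachable ?_)
              rw [SimpleGraph.fromEdgeSet_adj]
              exact ⟨hopen ha, hadj.ne⟩
        · intro e he
          rcases mem_O_hstep_edge.1 he with he | ⟨ha, rfl⟩
          · rw [hdes e (hinv.O_sub e he)]; exact ihO e he
          · have : desig S x₀ L N (ans :: b) s(u, v) = ê := by
              unfold desig
              rw [stateOf_cons_of_some hq, src_hstep_edge_self]
              unfold desigE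
              rw [hlam u hu]
              rfl
            rw [this]; exact hopen ha
      | bonus u =>
        obtain ⟨-, hu, hd, hY, hballopen⟩ := nq_bonus_spec hq
        have hux := qmk_lamOf (S := S) (x₀ := x₀) (L := L) (N := N) hG hact hu
        set x := lamOf S x₀ L N b u with hx
        refine ⟨?_, ?_⟩
        swap
        · intro e he
          rw [O_hstep_bonus] at he
          rw [hdes e (hinv.O_sub e he)]; exact ihO e he
        intro w hw
        rcases mem_A_hstep_bonus.1 hw with hw | ⟨ha, hwS⟩
        · rw [hlam w hw]; exact ihA w hw
        by_cases hwA : w ∈ (stOf b).A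
        · rw [hlam w hwA]; exact ihA w hwA
        -- a new sphere vertex: all probed coins were open
        have hall : ∀ c ∈ bonusCoins S N (stOf b) (lamOf S x₀ L N b) u, c ∈ ω := by
          have h := ha
          rw [hans] at h
          have h' : obs ω (bonusCoins S N (stOf b) (lamOf S x₀ L N b) u) = bonusCoins S N (stOf b) (lamOf S x₀ L N b) u :=
            answerG_bonus_iff.1 h
          intro c hc
          have : c ∈ obs ω (bonusCoins S N (stOf b) (lamOf S x₀ L N b) u) := by rw [h']; exact hc
          exact (mem_obs_iff.1 this).2
        -- non-designated candidates were read open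
        have hreal : ∀ f ∈ cand S x u, f ∉ desigSet G (stOf b) (lamOf S x₀ L N b) → f ∈ orEdges N G ω := by
          intro f hf hnd
          have hc : coin (Sum.inl f) (locIdx Γ G r N f u) ∈ bonusCoins S N (stOf b) (lamOf S x₀ L N b) u :=
            Finset.mem_union_left _ (mem_realCoins.2 ⟨f, hf, hnd, rfl⟩)
          exact mem_orEdges.2 ⟨cand_subset_edgeSet (S := S) hux hf, _, hall _ hc⟩
        -- witness edges are open: read now, or designated lifts of edges of the fully open ball
        have hwt : ∀ f ∈ S.wt x, f ∈ orEdges N G ω := by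
          intro f hfw
          by_cases hnd : f ∈ desigSet G (stOf b) (lamOf S x₀ L N b)
          · obtain ⟨e, he, hef⟩ := mem_desigSet_iff.1 hnd
            have hproj := projE_desig (S := S) (x₀ := x₀) (L := L) (N := N) hG hact he
            rw [hef] at hproj
            have heO : e ∈ (stOf b).O := by
              refine hballopen e ?_
              rw [mem_edgesInBallFin]
              induction f using Sym2.inductionOn with
              | hf a b' =>
                have hab := (S.wt_ball x _ hfw a (Sym2.mem_mk_left _ _)).2
                have hbb := (S.wt_ball x _ hfw b' (Sym2.mem_mk_right _ _)).2
                rw [hux] at hab hbb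
                simp only [projE, Sym2.map_mk] at hproj
                subst hproj
                rcases qmk_adj_or_eq (Γ := Γ) (S.wt_sub x hfw) with heq | hadj'
                · exfalso
                  obtain ⟨h1, h2, -⟩ := hinv.Qd_src _ he
                  have hd1 : (s(qmk Γ a, qmk Γ b') : Sym2 Qt).IsDiag := Sym2.mk_isDiag_iff.2 heq
                  rw [h1] at hd1
                  exact h2.ne (Sym2.mk_isDiag_iff.1 hd1)
                · exact mk_mem_edgesInBall_iff.2 ⟨hadj', hab, hbb⟩
            rw [← hef]
            exact ihO e heO
          · exact hreal f (mem_cand.2 (Or.inl hfw)) hnd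
        have hle : SimpleGraph.fromEdgeSet (↑(S.wt x) : Set (Sym2 V)) ≤ SimpleGraph.fromEdgeSet (orEdges N G ω) :=
          SimpleGraph.fromEdgeSet_mono fun f hf => hwt f hf
        have hx0 : (SimpleGraph.fromEdgeSet (orEdges N G ω)).Reachable x₀ x := ihA u hu
        -- the new lift is the tip of the chosen candidate
        rw [lamOf_cons, hq]
        simp only [ha, if_true, bonusLam, hwA, if_false, hwS]
        have hdist : (Hq).dist (qmk Γ x) w = r + 1 := by
          rw [hux]; rw [sphereF, Finset.mem_filter] at hwS; exact hwS.2
        obtain ⟨hbase, hbv, hf₁, hf₂, ht₁, ht₂, ha₁, ha₂, hne12, hr₁, hr₂⟩ := S.spec x w hdist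
        have hc₁ : s(S.foot₁ x w, S.tip₁ x w) ∈ cand S x u :=
          mem_cand.2 (Or.inr ⟨w, hwS, mem_candPair.2 (Or.inl rfl)⟩)
        have hc₂ : s(S.foot₂ x w, S.tip₂ x w) ∈ cand S x u :=
          mem_cand.2 (Or.inr ⟨w, hwS, mem_candPair.2 (Or.inr rfl)⟩)
        unfold pick
        rw [← hx]
        split_ifs with hdes1
        · -- the first candidate is designated; then the second is not
          have hnd2 : s(S.foot₂ x w, S.tip₂ x w) ∉ desigSet G (stOf b) (lamOf S x₀ L N b) := by
            intro h2
            obtain ⟨e₁, he₁, hd₁⟩ := mem_desigSet_iff.1 hdes1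
            obtain ⟨e₂, he₂, hd₂⟩ := mem_desigSet_iff.1 h2
            have p1 := projE_desig (S := S) (x₀ := x₀) (L := L) (N := N) hG hact he₁
            have p2 := projE_desig (S := S) (x₀ := x₀) (L := L) (N := N) hG hact he₂
            rw [hd₁] at p1
            rw [hd₂] at p2
            have h12 : e₁ = e₂ := by
              rw [← p1, ← p2]
              simp only [projE, Sym2.map_mk, hf₁, hf₂, ht₁, ht₂]
            subst h12
            exact hne12 (hd₁.symm.trans hd₂)
          have hopen₂ := hreal _ hc₂ hnd2
          refine hx0.trans ((hr₂.mono hle).trans (SimpleGraph.Adj.reachable ?_))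
          rw [SimpleGraph.fromEdgeSet_adj]
          exact ⟨hopen₂, ha₂.ne⟩
        · have hopen₁ := hreal _ hc₁ hdes1
          refine hx0.trans ((hr₁.mono hle).trans (SimpleGraph.Adj.reachable ?_))
          rw [SimpleGraph.fromEdgeSet_adj]
          exact ⟨hopen₁, ha₁.ne⟩

/-- **From the transcript event to the far event on the cover**: if the `𝒢`-side run has explored a
vertex at distance `≥ L`, then the OR-configuration `η = orEdges ω` lies in `Far_L`: the lift of that
vertex is `η`-connected to `x₀` and projects at distance `≥ L` ("`π(𝒞_𝒢^p(o'))` is infinite …").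
[cite: MartineauSevero2019, §5 (Proposition 4.1: "the coupling guarantees that π surjects C'_∞ onto C_∞")] -/
theorem farEvent_of_reachState (hG : G.Connected) (hact : IsActionByAut G Γ)
    (hN : ∀ u : Qt, 4 * r * (1 + ballVolume Hq u (r + 1)) + 2 * ballVolume Hq u (r + 1) ≤ N)
    (hNdom : ∀ e : Sym2 V, (dom Γ G r e).card ≤ N) (ω : Set (Sym2 (CoinH V N))) (k : ℕ)
    (h : ReachState Hq (qmk Γ x₀) L (stOf (btG S x₀ L N ω k))) :
    orEdges N G ω ∈ OrbitQuotient.farEvent Hq (qmk Γ) (qmk Γ x₀) x₀ L := by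
  obtain ⟨v, hv, hvL⟩ := h
  obtain ⟨hA, -⟩ := liftedCluster (S := S) (x₀ := x₀) (L := L) (N := N) hG hact hN hNdom ω k
  refine ⟨lamOf S x₀ L N (btG S x₀ L N ω k) v, hA v hv, ?_⟩
  rw [qmk_lamOf hG hact hv]
  exact hvL

end Cluster

/-! ### Proposition 4.1: the coupling inequality -/

section Prop41

/-- **Proposition 4.1 (the coupling inequality), finite-volume form.** For the block parameters
`p = 1-(1-p̂)^N`, `s = p̂^N` of `N` i.i.d. `Ber(p̂)` coins: `ℙ_{p,s}(𝓔_L(ℋ)) ≤ P^𝒢_p(Far_L)`, where `Far_L`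
is the event that the cluster of `x₀` in `𝒢` contains a vertex projecting at distance `≥ L` from `π x₀`.
Proof: both sides are read off the same exploration machine run on two fresh coin encodings with the same
transcript law (`TExplore.measureReal_setOf_bt_eq`); on the `ℋ`-side the transcript event is `𝓔_L` of the
decoded pair (`measureReal_reachState_H`), on the `𝒢`-side it forces `Far_L` for the OR of the copies
(`farEvent_of_reachState`), whose law is `P^𝒢_p` (`StarCoins.measureReal_preimage_orEdges`).
[cite: MartineauSevero2019, Proposition 4.1 and §5] -/
theorem enhMeasure_enhEvent_le_farEvent [Countable V] (hG : G.Connected) (hact : IsActionByAut G Γ)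
    (S : TwoLiftData Γ G r) (x₀ : V) (L N : ℕ) [NeZero N]
    (hN : ∀ u : Qt, 4 * r * (1 + ballVolume Hq u (r + 1)) + 2 * ballVolume Hq u (r + 1) ≤ N)
    (hNdom : ∀ e : Sym2 V, (dom Γ G r e).card ≤ N) (ph : unitInterval) :
    (EnhProp42.enhMeasure Hq (orParam ph N) (andParam ph N)).real (enhEvent Hq r (qmk Γ x₀) L) ≤
      (bondPercolation G (orParam ph N)).real (OrbitQuotient.farEvent Hq (qmk Γ) (qmk Γ x₀) x₀ L) := by
  haveI : Countable Qt := inferInstanceAs (Countable (Quotient (MulAction.orbitRel Γ V)))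
  have hH : (Hq).Connected := quot_connected hG
  rw [← measureReal_reachState_H (H := Hq) (o := qmk Γ x₀) (r := r) (L := L) (N := N) hH ph le_rfl,
    TExplore.measureReal_setOf_bt_eq (machine Hq (qmk Γ x₀) r L N) ph goodEnc_H
      (goodEnc_G (S := S) (x₀ := x₀) (L := L) (N := N) hG hact hN hNdom) (haltBound Hq (qmk Γ x₀) r L)
      (fun b => ReachState Hq (qmk Γ x₀) L (stateOf Hq (qmk Γ x₀) r L N b)),
    ← measureReal_preimage_orEdges (κ := V) (N := N) (G := G) ph
      (OrbitQuotient.measurableSet_farEvent Hq (qmk Γ) (qmk Γ x₀) x₀ L)]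
  exact MeasureTheory.measureReal_mono (fun ω hω => farEvent_of_reachState (S := S) hG hact hN hNdom ω _ hω)
    (MeasureTheory.measure_ne_top _ _)

end Prop41

end Coupling

end Literature.Probability.Percolation
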